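import Mathlib
import HarnessLib
import Literature.Analysis.FluidPDE.VectorCalculus
import Literature.Analysis.FluidPDE.VorticityCalculus
import Summits.NavierStokesRegularity.NavierStokesRegularity.Theses.LoopPeriodRatchet
import Summits.NavierStokesRegularity.NavierStokesRegularity.Theorems.PoloidalWindowDoorPoloidalWindowRigidityClebsch
import Summits.NavierStokesRegularity.NavierStokesRegularity.Theorems.LoopPeriodRatchetNoPlanarExtremumCore

/-!
# Route `LoopPeriodRatchet`, support `NoPlanarExtremum` (stmt-NavierStokesRegularity-22880) — proved

Support item (E1, topological) of the glued split of `OpenLoopLiouville` in the D-0145 line `LoopPeriodRatchet`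
(ideator ns-idea-1; bears on the DOOR rung N0-LocalTubeDoorPoloidal = `PoloidalWindowDoor.Target`; no summit and
no Clay option is proved here). Statement: for an e₃-poloidal Type-I Oseen-mild ancient profile `v` WITHOUT
closed vortex lines (every periodic orbit of `y′ = curl v(s)(y)`, `s < 0`, is stationary), every `s < 0` and
every `C²` horizontal potential `Φ` with `v₀ = ∂₀Φ`, `v₁ = ∂₁Φ` at time `s`, the plane stream function
`ψ = v₂ − ∂₂Φ` has NO STRICT local extremum inside any horizontal plane.

Proof. The slice `v s` is smooth (`…Clebsch.contDiff_slice`), so `X = curl v(s)` is `C²` and horizontal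
(`⟪curl v(s), e₂⟫ ≡ 0`), and by Schwarz's theorem for the `C²` potential `Φ` the in-plane gradient of `ψ ∈ C¹`
is `(∂₀ψ, ∂₁ψ) = (−X₁, X₀)`. A strict planar minimum of `ψ` therefore produces a non-stationary periodic orbit
of `X` (`…NoPlanarExtremumCore.exists_periodic_orbit_of_strict_planar_min`: Sard substitute for the planar
critical values + cut-off regular level-curve datum + Khovanskii's injective-or-periodic dichotomy from
`Literature.Analysis.ODE.LevelCurveData`), contradicting loop-freeness; a strict planar maximum is a strict
minimum of `−ψ`, the stream function of `−X`, whose periodic orbits are the time-reversed orbits of `X`.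
Helpers landed for this item: `…NoPlanarExtremumSard` (I), `…NoPlanarExtremumOrbit` (II), `…NoPlanarExtremumCore`
(III).
-/

noncomputable section

-- the summit and its single sub-problem share the name (CONVENTIONS §1), as in every Theorems file
set_option linter.dupNamespace false

namespace Summit.NavierStokesRegularity.NavierStokesRegularity.Theorems.LoopPeriodRatchetNoPlanarExtremum

open Set Function Filter Topology Metric
open scoped ContDiff
open Literature.Analysis Literature.Analysis.FluidPDE
open Summit.NavierStokesRegularity.NavierStokesRegularity.Theses.LoopPeriodRatchet
open Summit.NavierStokesRegularity.NavierStokesRegularity.Theorems.PoloidalWindowDoorPoloidalWindowRigidityClebsch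
open Summit.NavierStokesRegularity.NavierStokesRegularity.Theorems.LoopPeriodRatchetNoPlanarExtremumCore

/-- Time reversal: a periodic orbit of `−X` gives a periodic orbit of `X` through the same point. -/
theorem exists_periodic_orbit_neg {X : EuclideanSpace ℝ (Fin 3) → EuclideanSpace ℝ (Fin 3)}
    {γ : ℝ → EuclideanSpace ℝ (Fin 3)} {ℓ : ℝ} (hγ : ∀ θ, HasDerivAt γ (-(X (γ θ))) θ)
    (hper : ∀ θ, γ (θ + ℓ) = γ θ) :
    (∀ θ, HasDerivAt (fun θ => γ (-θ)) (X (γ (-θ))) θ) ∧ (∀ θ, γ (-(θ + ℓ)) = γ (-θ)) := by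
  refine ⟨fun θ => ?_, fun θ => ?_⟩
  · have h := (hγ (-θ)).scomp θ (hasDerivAt_neg θ)
    simp only [neg_smul, one_smul, neg_neg] at h
    exact h
  · have h := hper (-(θ + ℓ))
    rw [show -(θ + ℓ) + ℓ = -θ by ring] at h
    exact h.symm

/-- **`NoPlanarExtremum` (stmt-NavierStokesRegularity-22880).** Without closed vortex lines, the plane stream
function `ψ = v₂ − ∂₂Φ` of a slice of an e₃-poloidal Type-I Oseen-mild ancient profile has no strict local
extremum inside any horizontal plane. -/
theorem noPlanarExtremum_proof : NoPlanarExtremum := by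
  unfold NoPlanarExtremum
  intro C v hrate hcont hmild _hdiv hpol hloop s hs Φ hΦ hvΦ y₀
  -- the slice, its curl, the stream function
  have hV : ContDiff ℝ ∞ (v s) := contDiff_slice hrate hcont hmild hs
  have hVd : Differentiable ℝ (v s) := hV.differentiable (by simp)
  set X : EuclideanSpace ℝ (Fin 3) → EuclideanSpace ℝ (Fin 3) := curl (v s) with hX
  have hXc : ContDiff ℝ 2 X := contDiff_curl (n := 2) (hV.of_le (by norm_cast))
  have hX2 : ∀ y, X y 2 = 0 := fun y => curl_two_eq_zero hpol hs y
  set e0 : EuclideanSpace ℝ (Fin 3) := EuclideanSpace.single 0 1 with he0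
  set e1 : EuclideanSpace ℝ (Fin 3) := EuclideanSpace.single 1 1 with he1
  set e2 : EuclideanSpace ℝ (Fin 3) := EuclideanSpace.single 2 1 with he2
  -- second derivatives of the potential
  have hΦ1 : ContDiff ℝ 1 (fderiv ℝ Φ) := hΦ.fderiv_right (m := 1) (by norm_num)
  have hdΦ : Differentiable ℝ (fderiv ℝ Φ) := hΦ1.differentiable one_ne_zero
  have hsymm : ∀ y (u w : EuclideanSpace ℝ (Fin 3)),
      fderiv ℝ (fderiv ℝ Φ) y u w = fderiv ℝ (fderiv ℝ Φ) y w u :=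
    fun y u w => (hΦ.contDiffAt.isSymmSndFDerivAt (by simp)) u w
  have hΦw_c : ∀ w : EuclideanSpace ℝ (Fin 3), ContDiff ℝ 1 (fun y => fderiv ℝ Φ y w) := fun w =>
    (ContinuousLinearMap.apply ℝ ℝ w).contDiff.comp hΦ1
  have hΦw_d : ∀ (w : EuclideanSpace ℝ (Fin 3)) (y u : EuclideanSpace ℝ (Fin 3)),
      fderiv ℝ (fun y => fderiv ℝ Φ y w) y u = fderiv ℝ (fderiv ℝ Φ) y u w := by
    intro w y u
    have h := ((ContinuousLinearMap.apply ℝ ℝ w).hasFDerivAt.comp y (hdΦ y).hasFDerivAt).fderiv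
    rw [show (fun y => fderiv ℝ Φ y w) = (ContinuousLinearMap.apply ℝ ℝ w) ∘ fderiv ℝ Φ from rfl, h]
    rfl
  -- coordinates of the slice
  have hVi_d : ∀ (i : Fin 3) (y u : EuclideanSpace ℝ (Fin 3)),
      fderiv ℝ (fun y => v s y i) y u = fderiv ℝ (v s) y u i := by
    intro i y u
    have h := ((EuclideanSpace.proj i : EuclideanSpace ℝ (Fin 3) →L[ℝ] ℝ).hasFDerivAt.comp y
      (hVd y).hasFDerivAt).fderiv
    rw [show (fun y => v s y i) = (EuclideanSpace.proj i : EuclideanSpace ℝ (Fin 3) →L[ℝ] ℝ) ∘ v s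
      from rfl, h]
    rfl
  have hV2c : ContDiff ℝ 1 (fun y => v s y 2) :=
    (EuclideanSpace.proj (2 : Fin 3) : EuclideanSpace ℝ (Fin 3) →L[ℝ] ℝ).contDiff.comp
      (hV.of_le (by norm_cast))
  -- the potential relations as function identities
  have h0f : (fun y => v s y 0) = fun y => fderiv ℝ Φ y e0 := funext fun y => (hvΦ y).1
  have h1f : (fun y => v s y 1) = fun y => fderiv ℝ Φ y e1 := funext fun y => (hvΦ y).2
  have hD20 : ∀ y, fderiv ℝ (v s) y e2 0 = fderiv ℝ (fderiv ℝ Φ) y e2 e0 := by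
    intro y; rw [← hVi_d 0 y e2, h0f, hΦw_d]
  have hD21 : ∀ y, fderiv ℝ (v s) y e2 1 = fderiv ℝ (fderiv ℝ Φ) y e2 e1 := by
    intro y; rw [← hVi_d 1 y e2, h1f, hΦw_d]
  -- the stream function
  set ψ : EuclideanSpace ℝ (Fin 3) → ℝ := fun y => v s y 2 - fderiv ℝ Φ y e2 with hψ
  have hψc : ContDiff ℝ 1 ψ := hV2c.sub (hΦw_c e2)
  have hψ_d : ∀ y u, fderiv ℝ ψ y u = fderiv ℝ (v s) y u 2 - fderiv ℝ (fderiv ℝ Φ) y u e2 := by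
    intro y u
    rw [hψ, fderiv_fun_sub ((hV2c.differentiable one_ne_zero) y) (((hΦw_c e2).differentiable one_ne_zero) y),
      sub_apply, hVi_d, hΦw_d]
  have hcurl0 : ∀ y, X y 0 = fderiv ℝ (v s) y e1 2 - fderiv ℝ (v s) y e2 1 := fun y => by
    simp [hX, curl, he1, he2]
  have hcurl1 : ∀ y, X y 1 = fderiv ℝ (v s) y e2 0 - fderiv ℝ (v s) y e0 2 := fun y => by
    simp [hX, curl, he0, he2]
  have hψ0 : ∀ y, fderiv ℝ ψ y (EuclideanSpace.single 0 1) = -(X y 1) := by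
    intro y
    rw [← he0, hψ_d, hcurl1, hD20, hsymm y e0 e2]
    ring
  have hψ1 : ∀ y, fderiv ℝ ψ y (EuclideanSpace.single 1 1) = X y 0 := by
    intro y
    rw [← he1, hψ_d, hcurl0, hD21, hsymm y e1 e2]
  -- the two strict extrema
  refine ⟨fun hmin => ?_, fun hmax => ?_⟩
  · obtain ⟨γ, ℓ, hℓ, hγ, hper, hne⟩ :=
      exists_periodic_orbit_of_strict_planar_min hXc hX2 hψc hψ0 hψ1 (y₀ := y₀) hmin
    exact hne (hloop s hs γ ℓ hℓ hγ hper)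
  · -- maximum of `ψ` = minimum of `−ψ`, stream function of `−X`
    have hXn : ContDiff ℝ 2 (fun y => -X y) := hXc.neg
    have hXn2 : ∀ y, (-X y) 2 = 0 := fun y => by simp [hX2 y]
    have hψn : ContDiff ℝ 1 (fun y => -ψ y) := hψc.neg
    have hψn0 : ∀ y, fderiv ℝ (fun y => -ψ y) y (EuclideanSpace.single 0 1) = -((-X y) 1) := by
      intro y; rw [fderiv_fun_neg, neg_apply, hψ0]; simp
    have hψn1 : ∀ y, fderiv ℝ (fun y => -ψ y) y (EuclideanSpace.single 1 1) = (-X y) 0 := by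
      intro y; rw [fderiv_fun_neg, neg_apply, hψ1]; simp
    obtain ⟨γ, ℓ, hℓ, hγ, hper, hne⟩ :=
      exists_periodic_orbit_of_strict_planar_min hXn hXn2 hψn hψn0 hψn1 (y₀ := y₀)
        (hmax.mono fun y hy => neg_lt_neg hy)
    obtain ⟨hγ', hper'⟩ := exists_periodic_orbit_neg (X := X) hγ hper
    have h0 : X (γ (-0)) = 0 := hloop s hs (fun θ => γ (-θ)) ℓ hℓ hγ' hper'
    rw [neg_zero] at h0
    apply hne
    show -X (γ 0) = 0
    rw [h0, neg_zero]

end Summit.NavierStokesRegularity.NavierStokesRegularity.Theorems.LoopPeriodRatchetNoPlanarExtremum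

end
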